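import Literature.MathematicalPhysics.PowerSystems.KuramotoNonMinimumInstability
import Literature.MathematicalPhysics.PowerSystems.KuramotoSyncExponentialStability
import Literature.MathematicalPhysics.PowerSystems.StructurePreservingNormalOperationStability
import HarnessLib

/-!
# First-order tier (lossless non-uniform Kuramoto model / droop-controlled inverter network): «normal
# operation ⇒ stable» (Manik–Timme–Witthaut 2017, Cor. 1) and on a radial network «ONE IS STABLE and
# 2ᴺ⁻¹ − 1 are unstable» (Cor. 2) LITERALLY — both clauses, for the first-order motions

Topic `Literature/MathematicalPhysics/PowerSystems`, namespaces
`Literature.MathematicalPhysics.PowerSystems.NonuniformKuramoto` (§1–§3; lit-2's record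
`NonuniformKuramotoPhaseCohesiveness.lean`: `Dᵢθ̇ᵢ = ωᵢ − Σⱼ Pᵢⱼ sin(θᵢ − θⱼ + φᵢⱼ)`, `field`) and
`Literature.MathematicalPhysics.PowerSystems.DroopNetwork` (§4; `DroopControlledInverters.lean`:
`IsSolutionAt`, `IsAuxEquilibrium`, `avgFrequency`, `a = EᵢEⱼ|Yᵢⱼ|`, `linWeight`). The first-order
twin of `StructurePreservingNormalOperationStability.lean` (structure-preserving tier) and of
`NormalOperationStability.lean` (network-reduced tier, energy route). Companion of
`KuramotoNonMinimumInstability.lean` (gridfusion-lit-1: the UNSTABLE clause of Cor. 2 for the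
first-order motions, `NonuniformKuramoto.ncard_unstable_syncStates_of_tree`, and the static half of
«one is stable») and of `KuramotoSyncExponentialStability.lean` /
`DroopSyncExponentialStability.lean` (gridfusion-lit-2: Lemma 1's STABLE clause in certificate form,
`NonuniformKuramoto.lockedSolution_locally_expStable_of_posCurvature`,
`DroopNetwork.syncSolution_locally_expStable_of_posCurvature`; on trees in the arc form
`exists_expStable_equilibrium_iff_treeFlow_le` for unit time constants). Here the PSD + kernel
certificate is discharged from «normal operation» on a connected coupling graph with no arc hypothesis
(`ClassicalModel.posCurvature_of_cohesive_of_connected`), for general `Dᵢ > 0` and synchronous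
frequency `Σωᵢ/ΣDᵢ`, and on a radial network the two clauses of Cor. 2 are assembled into the printed
sentence. Everything below is PROVED (no definition, no named fact, no new axiom); the tree's
records and theorems are used unchanged.

SOURCES (read on the page this session).

* D. Manik, M. Timme, D. Witthaut, Chaos 27 (2017) 083123 [ManikTimmeWitthaut2017] (`lit read
  arxiv:1611.09825`, chunks p0004, p0010, p0011): **Lemma 1** (p0004 L46–L55: «… transversally
  asymptotically stable for both Kuramoto system and the power grid model system»), **Cor. 1**
  (p0004 L68–L77: «Consider a simply connected network. A fixed point θ* is transversally
  asymptotically stable if cos(θ*ᵢ − θ*ⱼ) > 0 holds for all edges (i, j) in the network … "normal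
  operation"»), **Cor. 2** (p0010 L120–L124: «In a tree network, there is either no fixed point or
  there are 2^{N−1} fixed points of which one is stable and 2^{N−1} − 1 are unstable»; proof p0011
  L12–L35).
* J. W. Simpson-Porco, F. Dörfler, F. Bullo, Automatica 49 (2013) [SimpsonporcoDorflerBullo2013]
  (`lit read arxiv:1206.5033`, chunk p0007 L71–L77): **Thm 2** «Consider the frequency-droop
  controlled system … defined on an acyclic network … (i) Synchronization: there exists an arc length
  γ ∈ [0, π/2[ such that the closed-loop system possess a locally exponentially stable and unique
  synchronized solution θ* ∈ Δ̄_G(γ) …» — the STABLE one of Cor. 2 in the inverter reading.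
* F. Dörfler, M. Chertkov, F. Bullo, PNAS 110 (2013), SI [DorflerChertkovBullo2013] (`lit read
  arxiv:1208.0045`, chunks p0016, p0019): §3.1 **Lemma 2** (Kuramoto model on a connected graph:
  Jacobian `−B diag(aᵢⱼcos(θᵢ − θⱼ))Bᵀ`, stable synchronization in `Δ_G(π/2)`), §3.2 **Thm 2 (G1)**
  (acyclic graphs: «there exists an exponentially stable equilibrium θ* ∈ Δ̄_G(γ) if and only if …»).

## What is proved (solutions `θ : ℝ → (Fin n → ℝ)` of `θ̇ = field(θ)` on `[0, T]`:
## `∀ t ∈ [0,T], HasDerivWithinAt θ (K.field (θ t)) (Icc 0 T) t`; `Dᵢ > 0`, `P` symmetric, `φ = 0`)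

* §1 **`NonuniformKuramoto.lockedSolution_locally_expStable_of_normalOperation`** — COROLLARY 1 for
  the first-order tier: `Pᵢⱼ ≥ 0` off the diagonal, connected coupling graph, a phase-locked state
  `θ₀` (`field(θ₀) = (Σωⱼ/ΣDⱼ)𝟙`) with `cos(θ₀ᵢ − θ₀ⱼ) > 0` on every coupled pair ⇒ `∃ ρ, k, λ > 0`:
  every solution on `[0, T]` with `‖θ(0) − θ₀‖ < ρ` satisfies
  `‖θ(t) − (θ₀ + c𝟙 + (Σω/ΣD)t𝟙)‖ ≤ k‖θ(0) − (θ₀ + c𝟙)‖e^{−λt}` on `[0, T]`, `c = Σ Dᵢ(θᵢ(0) − θ₀ᵢ)/Σ Dᵢ`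
  (lit-2's `lockedSolution_locally_expStable_of_posCurvature` with the certificate of
  `ClassicalModel.posCurvature_of_cohesive_of_connected`).
* §2 RADIAL, hypothesis-free: **`lockedSolution_locally_expStable_of_cohesive_of_tree`** — `P`
  supported on a rooted tree with positive edge weights, `cos(θcᵢ − θc_{parent i}) > 0` on every
  branch ⇒ the phase-locked solution `θc + (Σω/ΣD)t𝟙` is locally exponentially stable modulo rotation.
* §3 **`one_stable_and_ncard_unstable_syncStates_of_tree`** — COROLLARY 2, BOTH CLAUSES, LITERALLY,
  for the first-order motions on a radial network with strictly feasible tree flows: the pinned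
  phase-locked states of the period box other than the cohesive `θc` number exactly `2ⁿ⁻¹ − 1` and
  every one is an UNSTABLE synchronized solution (`ncard_unstable_syncStates_of_tree`, energy route),
  and `θc` is a locally exponentially STABLE one (§2, spectral route).
* §4 DROOP-CONTROLLED INVERTER NETWORKS (`DroopNetwork`, closed loop `IsSolutionAt` at every time):
  **`DroopNetwork.syncSolution_locally_expStable_of_normalOperation`** (Cor. 1 in the inverter
  reading: `aᵢⱼ ≥ 0`, connected, `cos > 0` on every line ⇒ the synchronized solution
  `θ₀ + ω_avg t𝟙` is locally exponentially stable modulo rotation) and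
  **`DroopNetwork.syncSolution_locally_expStable_of_cohesive_of_tree`** (radial, hypothesis-free:
  SPDB2013 Thm 2 (i)'s «locally exponentially stable» for the cohesive synchronized solution, with
  `cos > 0` on the branches in place of the arc).

DEVIATIONS FROM THE PRINTED PROOF. As in the structure-preserving twin: Cor. 1's Laplacian step on
the quadratic form, Lemma 1's stable clause = the tree's linearisation theorem (so the conclusion is
local EXPONENTIAL stability modulo rotation), the unstable clause of Cor. 2 = the tree's energy-route
theorem; no arc hypothesis is used for the stable clause (only the signs of the residual couplings
`Pᵢⱼcos(θᵢ − θⱼ)`), so pinned states of the period box whose line angles wrap are covered.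

THREE COLUMNS (LADDER-GRIDFUSION honest framing). CERTIFIED for MODEL `M` = lossless non-uniform
Kuramoto model `Dᵢθ̇ᵢ = ωᵢ − Σⱼ Pᵢⱼ sin(θᵢ − θⱼ)` (`Dᵢ > 0`, `P` symmetric) ≡ droop-controlled
all-inverter microgrid with inductive lines and constant voltages (MODEL-VALIDITY first-order /
inverter rows); CLASS `C` = solutions from the `ρ`-ball around the phase-locked state (stable clause;
`ρ, k, λ` existential) / phases on the level of the state arbitrarily close (unstable clause).
«Stable» / «unstable» refer to synchronized solutions of MODEL `M`, never to a microgrid or a grid.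
NOT CLAIMED: the size of `ρ` or the rate; meshed networks beyond §1/§4 (a certificate must be
supplied); anything about a physical system.
-/

noncomputable section

open Real Set Filter Topology Metric Finset
open scoped Matrix

namespace Literature.MathematicalPhysics.PowerSystems

/-! ### §1. COROLLARY 1 for the first-order tier: normal operation on a connected network ⇒ the
phase-locked solution is locally exponentially STABLE modulo rotation -/

namespace NonuniformKuramoto

variable {n : ℕ} (K : NonuniformKuramoto n)

/-- **COROLLARY 1 OF MANIK–TIMME–WITTHAUT FOR THE KURAMOTO SYSTEM: «normal operation» on a connected
network ⇒ the phase-locked solution is (locally exponentially) STABLE modulo rotation** (`Dᵢ > 0`,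
`φ = 0`, `P` symmetric with `Pᵢⱼ ≥ 0` off the diagonal, connected coupling graph `CouplingConnected P`).
If `θ₀` is a phase-locked state (`fieldᵢ(θ₀) = Σωⱼ/ΣDⱼ` at every node) with `cos(θ₀ᵢ − θ₀ⱼ) > 0` on
every coupled pair (`Pᵢⱼ > 0`), then there are `ρ, k, λ > 0` such that every solution on `[0, T]`
with `‖θ(0) − θ₀‖ < ρ` satisfies `‖θ(t) − (θ₀ + c𝟙 + (Σωⱼ/ΣDⱼ)t𝟙)‖ ≤ k‖θ(0) − (θ₀ + c𝟙)‖e^{−λt}` on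
`[0, T]`, `c = Σᵢ Dᵢ(θᵢ(0) − θ₀ᵢ)/Σᵢ Dᵢ`. «A fixed point θ* is transversally asymptotically stable if
cos(θ*ᵢ − θ*ⱼ) > 0 holds for all edges» — for the first-order motions, with a rate. THREE COLUMNS:
CERTIFIED for MODEL `M` = lossless non-uniform Kuramoto model, CLASS `C` = the `ρ`-ball; «stable» =
the phase-locked solution of MODEL `M`.
[cite: ManikTimmeWitthaut2017, §3 Cor. 1 («normal operation») with Lemma 1 («for both Kuramoto system and the power grid model»); DorflerChertkovBullo2013, SI §3.1 Lemma 2 (2)] -/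
theorem lockedSolution_locally_expStable_of_normalOperation (hD : ∀ i, 0 < K.D i)
    (hφ : ∀ i j, K.φ i j = 0) (hP : ∀ i j, K.P i j = K.P j i) (hP0 : ∀ i j, i ≠ j → 0 ≤ K.P i j)
    (hconn : ClassicalModel.CouplingConnected K.P) {θ₀ : Fin n → ℝ}
    (hθ₀ : ∀ i, K.field θ₀ i = (∑ j, K.ω j) / ∑ j, K.D j)
    (hcoh : ∀ i j, i ≠ j → 0 < K.P i j → 0 < Real.cos (θ₀ i - θ₀ j)) :
    ∃ ρ > 0, ∃ k > 0, ∃ lam > 0, ∀ (θ : ℝ → Fin n → ℝ) (T : ℝ),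
      (∀ t ∈ Icc 0 T, HasDerivWithinAt θ (K.field (θ t)) (Icc 0 T) t) → ‖θ 0 - θ₀‖ < ρ →
      ∀ t ∈ Icc 0 T,
        ‖θ t - fun i => θ₀ i + K.D ⬝ᵥ (θ 0 - θ₀) / (∑ i, K.D i) + (∑ j, K.ω j) / (∑ j, K.D j) * t‖
          ≤ k * ‖θ 0 - fun i => θ₀ i + K.D ⬝ᵥ (θ 0 - θ₀) / ∑ i, K.D i‖ * Real.exp (-lam * t) := by
  have hcert := ClassicalModel.posCurvature_of_cohesive_of_connected hP hconn (θ := θ₀)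
    fun i j hij hne => by
      have hpos : 0 < K.P i j := lt_of_le_of_ne (hP0 i j hij) (Ne.symm hne)
      exact mul_pos hpos (hcoh i j hij hpos)
  exact K.lockedSolution_locally_expStable_of_posCurvature hD hφ hP hθ₀ hcert.1 hcert.2

/-! ### §2. RADIAL NETWORKS, hypothesis-free: the phase-cohesive locked state is locally exponentially
STABLE for the first-order motions -/

/-- **On a radial network the PHASE-COHESIVE phase-locked solution of the first-order model is
locally exponentially STABLE modulo rotation** (`Dᵢ > 0`, `φ = 0`, `P` symmetric and supported on a
rooted tree with positive edge weights; NO isolation, census, arc or connectivity hypothesis beyond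
the tree data): if `fieldᵢ(θc) = Σωⱼ/ΣDⱼ` at every node and `cos(θcᵢ − θc_{parent i}) > 0` on every
branch, then `∃ ρ, k, λ > 0`: every solution on `[0, T]` with `‖θ(0) − θc‖ < ρ` satisfies
`‖θ(t) − (θc + c𝟙 + (Σωⱼ/ΣDⱼ)t𝟙)‖ ≤ k‖θ(0) − (θc + c𝟙)‖e^{−λt}` on `[0, T]`. This is the «one is
stable» of Cor. 2 / the «locally exponentially stable … synchronized solution» of SPDB2013 Thm 2 (i)
AT THE LEVEL OF THE MOTIONS; its companions with a negative-cosine branch are unstable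
(`unstable_syncSolution_of_neg_branch_of_tree`). THREE COLUMNS: CERTIFIED for MODEL `M` = lossless
non-uniform Kuramoto model on a radial network, CLASS `C` = the `ρ`-ball; «stable» = the phase-locked
solution of MODEL `M`.
[cite: ManikTimmeWitthaut2017, §5.2 Cor. 2 («one is stable») with §3 Cor. 1; SimpsonporcoDorflerBullo2013, §3 Thm 2 (i); DorflerChertkovBullo2013, SI §3.2 Thm 2 (G1)] -/
theorem lockedSolution_locally_expStable_of_cohesive_of_tree (hD : ∀ i, 0 < K.D i)
    (hφ : ∀ i j, K.φ i j = 0) (hP : ∀ i j, K.P i j = K.P j i)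
    {root : Fin n} {parent : Fin n → Fin n} {depth : Fin n → ℕ}
    (hdepth : ∀ i, i ≠ root → depth i = depth (parent i) + 1)
    (htree : ∀ i j, i ≠ j → K.P i j ≠ 0 → (i ≠ root ∧ j = parent i) ∨ (j ≠ root ∧ i = parent j))
    (ha : ∀ i, i ≠ root → 0 < K.P i (parent i)) {θc : Fin n → ℝ}
    (hec : ∀ i, K.field θc i = (∑ j, K.ω j) / ∑ j, K.D j)
    (hcoh : ∀ i, i ≠ root → 0 < Real.cos (θc i - θc (parent i))) :
    ∃ ρ > 0, ∃ k > 0, ∃ lam > 0, ∀ (θ : ℝ → Fin n → ℝ) (T : ℝ),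
      (∀ t ∈ Icc 0 T, HasDerivWithinAt θ (K.field (θ t)) (Icc 0 T) t) → ‖θ 0 - θc‖ < ρ →
      ∀ t ∈ Icc 0 T,
        ‖θ t - fun i => θc i + K.D ⬝ᵥ (θ 0 - θc) / (∑ i, K.D i) + (∑ j, K.ω j) / (∑ j, K.D j) * t‖
          ≤ k * ‖θ 0 - fun i => θc i + K.D ⬝ᵥ (θ 0 - θc) / ∑ i, K.D i‖ * Real.exp (-lam * t) := by
  have hcert := ClassicalModel.posCurvature_of_cohesive_of_rootedTree hdepth hP htree ha hcoh
  exact K.lockedSolution_locally_expStable_of_posCurvature hD hφ hP hec hcert.1 hcert.2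

/-! ### §3. COROLLARY 2, BOTH CLAUSES, LITERALLY, for the first-order motions on a radial network -/

/-- **«Of the `2ᴺ⁻¹` fixed points … ONE IS STABLE and `2ᴺ⁻¹ − 1` are unstable» — LITERALLY, for the
first-order motions (lossless non-uniform Kuramoto model) on a radial network** (`Dᵢ > 0`, `φ = 0`,
`P` symmetric, tree-supported with positive edge weights, strictly feasible tree flows
`|uᵢ| < P_{i, parent i}` of the synchronous-frame frequencies `ωᵢ − Dᵢ(Σωⱼ/ΣDⱼ)`). With `θc` the
pinned phase-cohesive locked state of the period box `[−π, π)ⁿ` (`cos > 0` on every branch):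
(i) the pinned locked states of the box other than `θc` number exactly `2ⁿ⁻¹ − 1` and EVERY one of
them is an UNSTABLE synchronized solution (`∃ ε > 0 ∀ r > 0 ∃ θ₁` on its level with
`dist(θ₁, θe) < r`: every solution from `θ₁` gets farther than `ε` from `θe + (Σω/ΣD)t𝟙`;
`ncard_unstable_syncStates_of_tree`, energy route); (ii) `θc` is a locally exponentially STABLE
synchronized solution in the sense of `lockedSolution_locally_expStable_of_cohesive_of_tree`
(spectral route). THREE COLUMNS: CERTIFIED for MODEL `M` = lossless non-uniform Kuramoto model on a
radial network, every `D > 0`; «stable» / «unstable» = synchronized solutions of MODEL `M`.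
[cite: ManikTimmeWitthaut2017, §5.2 Cor. 2 («there are 2^{N−1} fixed points of which one is stable and 2^{N−1} − 1 are unstable») and its proof; SimpsonporcoDorflerBullo2013, §3 Thm 2; DorflerChertkovBullo2013, SI §3.2 Thm 2 (G1); Chiang1995, §3 Thm 3.1] -/
theorem one_stable_and_ncard_unstable_syncStates_of_tree (hD : ∀ i, 0 < K.D i)
    (hP : ∀ i j, K.P i j = K.P j i) (hφ : ∀ i j, K.φ i j = 0)
    {root : Fin n} {parent : Fin n → Fin n} {depth : Fin n → ℕ} (hpr : parent root = root)
    (hroot : depth root = 0) (hdepth : ∀ i, i ≠ root → depth i = depth (parent i) + 1)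
    (htree : ∀ i j, i ≠ j → K.P i j ≠ 0 → (i ≠ root ∧ j = parent i) ∨ (j ≠ root ∧ i = parent j))
    (ha : ∀ i, i ≠ root → 0 < K.P i (parent i)) (u : Fin n → ℝ)
    (hcons : ∀ i, K.ω i - K.D i * ((∑ j, K.ω j) / ∑ j, K.D j) = (if i ≠ root then u i else 0)
      - ∑ j ∈ Finset.univ.filter (fun j => j ≠ root ∧ parent j = i), u j)
    (hu : ∀ i, i ≠ root → |u i| < K.P i (parent i))
    {θc : Fin n → ℝ} (hrc : θc root = 0) (hboxc : ∀ i, θc i ∈ Set.Ico (-π) π)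
    (hec : ∀ k, K.field θc k = (∑ j, K.ω j) / ∑ j, K.D j)
    (hcoh : ∀ i, i ≠ root → 0 < Real.cos (θc i - θc (parent i))) :
    ({θ : Fin n → ℝ | θ root = 0 ∧ (∀ i, θ i ∈ Set.Ico (-π) π) ∧
        ∀ k, K.field θ k = (∑ j, K.ω j) / ∑ j, K.D j} \ {θc}).ncard = 2 ^ (n - 1) - 1 ∧
      (∀ θe ∈ {θ : Fin n → ℝ | θ root = 0 ∧ (∀ i, θ i ∈ Set.Ico (-π) π) ∧
          ∀ k, K.field θ k = (∑ j, K.ω j) / ∑ j, K.D j} \ {θc},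
        ∃ ε > 0, ∀ r > 0, ∃ θ₁ : Fin n → ℝ, dist θ₁ θe < r ∧
          ∑ k, K.D k * θ₁ k = ∑ k, K.D k * θe k ∧
          ∀ θ : ℝ → Fin n → ℝ, θ 0 = θ₁ →
            (∀ T : ℝ, ∀ t ∈ Icc 0 T, HasDerivWithinAt θ (K.field (θ t)) (Icc 0 T) t) →
            ∃ t, 0 ≤ t ∧ ε < dist (θ t) (fun j => θe j + (∑ j, K.ω j) / (∑ j, K.D j) * t)) ∧
      ∃ ρ > 0, ∃ k > 0, ∃ lam > 0, ∀ (θ : ℝ → Fin n → ℝ) (T : ℝ),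
        (∀ t ∈ Icc 0 T, HasDerivWithinAt θ (K.field (θ t)) (Icc 0 T) t) → ‖θ 0 - θc‖ < ρ →
        ∀ t ∈ Icc 0 T,
          ‖θ t - fun i => θc i + K.D ⬝ᵥ (θ 0 - θc) / (∑ i, K.D i) + (∑ j, K.ω j) / (∑ j, K.D j) * t‖
            ≤ k * ‖θ 0 - fun i => θc i + K.D ⬝ᵥ (θ 0 - θc) / ∑ i, K.D i‖ * Real.exp (-lam * t) := by
  obtain ⟨h1, h2⟩ := K.ncard_unstable_syncStates_of_tree hD hP hφ hpr hroot hdepth htree ha u hcons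
    hu hrc hboxc hec (fun i hi => (hcoh i hi).le)
  exact ⟨h1, h2,
    K.lockedSolution_locally_expStable_of_cohesive_of_tree hD hφ hP hdepth htree ha hec hcoh⟩

end NonuniformKuramoto

/-! ### §4. DROOP-CONTROLLED INVERTER NETWORKS (SPDB2013's closed loop `DroopNetwork.IsSolutionAt`):
Cor. 1 and the radial stable clause in the inverter reading -/

namespace DroopNetwork

variable {n : ℕ} (N : DroopNetwork n)

/-- **COROLLARY 1 IN THE INVERTER READING: normal operation on a connected lossless all-inverter
network ⇒ the synchronized solution is locally exponentially STABLE modulo rotation** (`Dᵢ > 0`,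
`|Yᵢⱼ|` symmetric, couplings `aᵢⱼ = EᵢEⱼ|Yᵢⱼ| ≥ 0` off the diagonal, connected coupling graph
`CouplingConnected a`, a synchronized state `θ₀` of (Aux) with `cos(θ₀ᵢ − θ₀ⱼ) > 0` on every line
`aᵢⱼ > 0`): `∃ ρ, k, λ > 0`, every closed-loop solution (`IsSolutionAt` at every time) with
`‖θ(0) − θ₀‖ < ρ` satisfies `‖θ(t) − (θ₀ + c𝟙 + ω_avg t𝟙)‖ ≤ k‖θ(0) − (θ₀ + c𝟙)‖e^{−λt}` for
`t ≥ 0`, `c = Σ Dᵢ(θᵢ(0) − θ₀ᵢ)/Σ Dᵢ` (lit-2's `syncSolution_locally_expStable_of_posCurvature` with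
the certificate of `ClassicalModel.posCurvature_of_cohesive_of_connected`; no arc hypothesis).
THREE COLUMNS: CERTIFIED for MODEL `M` = droop-controlled all-inverter microgrid with inductive lines
and constant voltages, CLASS `C` = the `ρ`-ball; «stable» = the synchronized solution of MODEL `M`,
never a microgrid.
[cite: ManikTimmeWitthaut2017, §3 Cor. 1 with Lemma 1; SimpsonporcoDorflerBullo2013, §3 Lemma 1 and proof of Thm 2 (b) («L(θ*) is a Laplacian and thus positive semidefinite»)] -/
theorem syncSolution_locally_expStable_of_normalOperation (hY : ∀ i j, N.Yabs i j = N.Yabs j i)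
    (hD : ∀ i, 0 < N.Dc i) (ha0 : ∀ i j, i ≠ j → 0 ≤ N.a i j)
    (hconn : ClassicalModel.CouplingConnected N.a) {θ₀ : Fin n → ℝ} (hθ₀ : N.IsAuxEquilibrium θ₀)
    (hcoh : ∀ i j, i ≠ j → 0 < N.a i j → 0 < Real.cos (θ₀ i - θ₀ j)) :
    ∃ ρ > 0, ∃ k > 0, ∃ lam > 0, ∀ θ : ℝ → Fin n → ℝ, (∀ t, N.IsSolutionAt θ t) → ‖θ 0 - θ₀‖ < ρ →
      ∀ t : ℝ, 0 ≤ t →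
        ‖θ t - fun i => θ₀ i + N.Dc ⬝ᵥ (θ 0 - θ₀) / (∑ i, N.Dc i) + N.avgFrequency * t‖
          ≤ k * ‖θ 0 - fun i => θ₀ i + N.Dc ⬝ᵥ (θ 0 - θ₀) / ∑ i, N.Dc i‖ * Real.exp (-lam * t) := by
  have hcert := ClassicalModel.posCurvature_of_cohesive_of_connected
    (fun i j => DroopNetwork.a_symm hY i j) hconn (θ := θ₀) fun i j hij hne => by
      have hpos : 0 < N.a i j := lt_of_le_of_ne (ha0 i j hij) (Ne.symm hne)
      exact mul_pos hpos (hcoh i j hij hpos)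
  exact syncSolution_locally_expStable_of_posCurvature hY hD hθ₀ (fun u => hcert.1 u)
    (fun u hu => hcert.2 u hu)

/-- **On a radial lossless all-inverter network the PHASE-COHESIVE synchronized solution of the droop
closed loop is locally exponentially STABLE modulo rotation** (`Dᵢ > 0`, `|Yᵢⱼ|` symmetric,
couplings `a = EᵢEⱼ|Yᵢⱼ|` supported on a rooted tree with positive line couplings; a synchronized
state `θc` of (Aux) with `cos(θcᵢ − θc_{parent i}) > 0` on every branch; NO isolation, census, arc or
further connectivity hypothesis): `∃ ρ, k, λ > 0`, every closed-loop solution with `‖θ(0) − θc‖ < ρ`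
satisfies `‖θ(t) − (θc + c𝟙 + ω_avg t𝟙)‖ ≤ k‖θ(0) − (θc + c𝟙)‖e^{−λt}` for `t ≥ 0`. This is the
«locally exponentially stable … synchronized solution» of SPDB2013 Thm 2 (i) with `cos > 0` on the
branches in place of the arc, and the «one is stable» of MTW2017 Cor. 2 in the inverter reading (its
companions with a negative-cosine branch are unstable, `unstable_syncSolution_of_neg_branch_of_tree`).
THREE COLUMNS: CERTIFIED for MODEL `M` = droop-controlled all-inverter microgrid on a radial network,
CLASS `C` = the `ρ`-ball; «stable» = the synchronized solution of MODEL `M`.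
[cite: SimpsonporcoDorflerBullo2013, §3 Thm 2 (i) («locally exponentially stable and unique synchronized solution»); ManikTimmeWitthaut2017, §5.2 Cor. 2 with §3 Cor. 1] -/
theorem syncSolution_locally_expStable_of_cohesive_of_tree (hY : ∀ i j, N.Yabs i j = N.Yabs j i)
    (hD : ∀ i, 0 < N.Dc i) {root : Fin n} {parent : Fin n → Fin n} {depth : Fin n → ℕ}
    (hdepth : ∀ i, i ≠ root → depth i = depth (parent i) + 1)
    (htree : ∀ i j, i ≠ j → N.a i j ≠ 0 → (i ≠ root ∧ j = parent i) ∨ (j ≠ root ∧ i = parent j))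
    (ha : ∀ i, i ≠ root → 0 < N.a i (parent i)) {θc : Fin n → ℝ} (hθc : N.IsAuxEquilibrium θc)
    (hcoh : ∀ i, i ≠ root → 0 < Real.cos (θc i - θc (parent i))) :
    ∃ ρ > 0, ∃ k > 0, ∃ lam > 0, ∀ θ : ℝ → Fin n → ℝ, (∀ t, N.IsSolutionAt θ t) → ‖θ 0 - θc‖ < ρ →
      ∀ t : ℝ, 0 ≤ t →
        ‖θ t - fun i => θc i + N.Dc ⬝ᵥ (θ 0 - θc) / (∑ i, N.Dc i) + N.avgFrequency * t‖
          ≤ k * ‖θ 0 - fun i => θc i + N.Dc ⬝ᵥ (θ 0 - θc) / ∑ i, N.Dc i‖ * Real.exp (-lam * t) := by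
  have hcert := ClassicalModel.posCurvature_of_cohesive_of_rootedTree hdepth
    (fun i j => DroopNetwork.a_symm hY i j) htree ha hcoh
  exact syncSolution_locally_expStable_of_posCurvature hY hD hθc (fun u => hcert.1 u)
    (fun u hu => hcert.2 u hu)

end DroopNetwork

end Literature.MathematicalPhysics.PowerSystems

end
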